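import Mathlib
import Summits.NavierStokesRegularity.NavierStokesRegularity.Theorems.EulerZoomLiouvillePowerGaugeEulerLiouvilleNeedleCauchyLocal
import Summits.NavierStokesRegularity.NavierStokesRegularity.Theorems.EulerZoomLiouvillePowerGaugeEulerLiouvilleNeedleLiouvilleLocal

/-!
# RESIDENCE IS UNIFORMLY HYPERBOLIC along lingering backward cut-off orbits (plate t40c of ROUND-40, nsreg-p2 g33's spec)

Width piece for crux `EulerZoomLiouville.PowerGaugeEulerLiouville` (stmt-NavierStokesRegularity-19832), by name under
LEAD 19832 (ns-typeII-p2 g12); seat ns-in-ser-c g3 (director-ns inputs-36), `--supports stmt-NavierStokesRegularity-19832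
--as helper`.  Composition of the two ROUND-40 seeds already in the tree:

* t40a `norm_fderiv_flow_curl_le_linger` (…NeedleCauchyLocal, VORTEX-LINE CRUSHING): along an orbit of the backward
  cut-off similarity flow `Ψ_σ := Φ^V_{−σ}` that lingers in `B̄_M ⊂ ball 0 R_big` during `[0, L]`,
  `‖DΨ_σ(y)[Ω(y)]‖ ≤ e^{−(1+γ)σ}·O` (`O ≥ sup_{B̄_M}‖curl U‖`);
* t40b `det_fderiv_flow_neg_linger` (…NeedleLiouvilleLocal, LOCAL LIOUVILLE LAW): `det DΨ_σ(y) = e^{−3γσ}`.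

THIS FILE.

* (H1) `abs_det_le_norm_apply_mul_opNorm_sq` — pure linear algebra on `ℝ³`: for every linear map `J` and unit vector `e`,
  `|det J| ≤ ‖J e‖ · ‖J‖²` (pick a unit `b ⊥ e`, `c := e × b`; `det J = det J · ⟪e, b × c⟫ = ⟪J e, J b × J c⟫` by the
  multiplicativity of the triple product `det_mul_inner_cross`; Cauchy–Schwarz and Lagrange `‖u × v‖ ≤ ‖u‖‖v‖`), with the two
  tools it needs (`apply_eq_sum_toMatrix`, `exists_norm_eq_one_inner_eq_zero`); coordinate identities are kept LOCAL (`have`) —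
  the tree already has them by name elsewhere (`Tao2016.real_inner_fin3`, `Tao2016.norm_cross_sq`, …), not re-declared here.
* (H2) `norm_fderiv_flow_sq_ge_linger` — **RESIDENCE IS UNIFORMLY HYPERBOLIC**: under the hypotheses of t40a/t40b,
  `∀ σ ∈ [0, L], ‖curl U y‖ · e^{(1−2γ)σ} ≤ O · ‖DΨ_σ(y)‖²`
  [(H1) with `e = Ω̂(y)` when `curl U y ≠ 0` (trivial otherwise): `e^{−3γσ} = det DΨ_σ(y) ≤ ‖DΨ_σ(y)Ω̂(y)‖ ‖DΨ_σ(y)‖²`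
  and `‖DΨ_σ(y)Ω(y)‖ ≤ e^{−(1+γ)σ}·O`];  `norm_fderiv_flow_sq_ge_linger'` packages `O` as in t40a.

MEANING (nsreg-p2 g33, ROUND-40): every label that lingers in `B̄_M` for backward time `σ` with `‖Ω(y)‖ ≥ ω` carries a
direction stretched by `≥ (ω/O)^{1/2} e^{ργσ/2}` (`1 − 2γ = ργ` at `γ = 1/(2+ρ)`) — the hovering exponent of ROUND-39 (K4)
with NO linearisation and NO node hypothesis; the Lagrangian form of «the waiting room is hyperbolic».  Not a kill by itself
(long stretched filaments may fold inside `B̄_{2R}`); it is the typed input for the R40 residence/hovering law.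

HONEST FRAMING: statements about the flow of HYPOTHETICAL self-similar Euler profiles (blow-up needles); nothing here proves
the crux E `PowerGaugeEulerLiouville` (19832 OPEN), any door Target, or any Navier–Stokes regularity statement; no summit
statement is touched.  [cite: ConstantinIgnatovaVicol2026Putative, §3.4.1 eq. (3.22)–(3.24); folklore (Hadamard)]
-/

noncomputable section

open Set Filter Topology Metric Function MeasureTheory
open scoped RealInnerProductSpace Matrix NNReal ENNReal

set_option linter.dupNamespace false

namespace Summit.NavierStokesRegularity.NavierStokesRegularity.Theorems.PowerGaugeEulerLiouville.NeedleClock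

open Literature.Analysis Literature.Analysis.FluidPDE
open Summit.NavierStokesRegularity.NavierStokesRegularity.Theorems.PowerGaugeEulerLiouville

/-! ## (H1) Linear algebra on `ℝ³`: `|det J| ≤ ‖J e‖ · ‖J‖²` -/

/-- Coordinates of a linear map of `ℝ³` through its standard matrix:
`(J x)ᵢ = Σⱼ Mᵢⱼ xⱼ`, `M = toMatrix (basisFun) (basisFun) J`. [folklore] -/
theorem apply_eq_sum_toMatrix (J : EuclideanSpace ℝ (Fin 3) →ₗ[ℝ] EuclideanSpace ℝ (Fin 3))
    (x : EuclideanSpace ℝ (Fin 3)) (i : Fin 3) :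
    J x i = ∑ j, LinearMap.toMatrix (EuclideanSpace.basisFun (Fin 3) ℝ).toBasis
      (EuclideanSpace.basisFun (Fin 3) ℝ).toBasis J i j * x j := by
  have h := LinearMap.toMatrix_mulVec_repr (EuclideanSpace.basisFun (Fin 3) ℝ).toBasis
    (EuclideanSpace.basisFun (Fin 3) ℝ).toBasis J x
  have hi := congrFun h i
  rw [OrthonormalBasis.coe_toBasis_repr_apply, EuclideanSpace.basisFun_repr] at hi
  rw [← hi, Matrix.mulVec, dotProduct]
  refine Finset.sum_congr rfl fun j _ => ?_
  rw [OrthonormalBasis.coe_toBasis_repr_apply, EuclideanSpace.basisFun_repr]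

/-- **Multiplicativity of the triple product**: `det J · ⟪e, b × c⟫ = ⟪J e, J b × J c⟫` for every linear map `J` of
`ℝ³` and all vectors `e, b, c` (the alternating trilinear form `(e,b,c) ↦ ⟪Je, Jb × Jc⟫` is `det J` times the volume
form). [folklore] -/
theorem det_mul_inner_cross (J : EuclideanSpace ℝ (Fin 3) →ₗ[ℝ] EuclideanSpace ℝ (Fin 3))
    (e b c : EuclideanSpace ℝ (Fin 3)) :
    LinearMap.det J * ⟪e, cross b c⟫ = ⟪J e, cross (J b) (J c)⟫ := by
  set M := LinearMap.toMatrix (EuclideanSpace.basisFun (Fin 3) ℝ).toBasis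
    (EuclideanSpace.basisFun (Fin 3) ℝ).toBasis J with hM
  rw [← LinearMap.det_toMatrix (EuclideanSpace.basisFun (Fin 3) ℝ).toBasis J, ← hM]
  -- coordinates of `⟪·,·⟫` and `×` on `ℝ³`
  have hi : ∀ x y : EuclideanSpace ℝ (Fin 3), ⟪x, y⟫ = x 0 * y 0 + x 1 * y 1 + x 2 * y 2 := fun x y => by
    simp [PiLp.inner_apply, Fin.sum_univ_three, mul_comm]
  have hc0 : ∀ v w : EuclideanSpace ℝ (Fin 3), cross v w 0 = v 1 * w 2 - v 2 * w 1 := fun v w => by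
    simp [cross, cross_apply]
  have hc1 : ∀ v w : EuclideanSpace ℝ (Fin 3), cross v w 1 = v 2 * w 0 - v 0 * w 2 := fun v w => by
    simp [cross, cross_apply]
  have hc2 : ∀ v w : EuclideanSpace ℝ (Fin 3), cross v w 2 = v 0 * w 1 - v 1 * w 0 := fun v w => by
    simp [cross, cross_apply]
  rw [hi, hi, hc0, hc1, hc2, hc0, hc1, hc2]
  simp only [apply_eq_sum_toMatrix J, ← hM, Fin.sum_univ_three, Matrix.det_fin_three]
  ring

/-- In `ℝ³` every vector has a unit vector orthogonal to it (`dim (ℝe)ᗮ = 2 > 0`). [folklore] -/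
theorem exists_norm_eq_one_inner_eq_zero (e : EuclideanSpace ℝ (Fin 3)) :
    ∃ b : EuclideanSpace ℝ (Fin 3), ‖b‖ = 1 ∧ ⟪e, b⟫ = 0 := by
  by_cases he : e = 0
  · refine ⟨EuclideanSpace.single 0 1, ?_, ?_⟩
    · simp
    · rw [he, inner_zero_left]
  have hK : (Submodule.span ℝ ({e} : Set (EuclideanSpace ℝ (Fin 3))))ᗮ ≠ ⊥ := by
    intro h
    have h1 := Submodule.finrank_add_finrank_orthogonal (Submodule.span ℝ ({e} : Set (EuclideanSpace ℝ (Fin 3))))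
    rw [h, finrank_bot, add_zero, finrank_euclideanSpace_fin, finrank_span_singleton he] at h1
    omega
  obtain ⟨b₀, hb₀K, hb₀⟩ := Submodule.exists_mem_ne_zero_of_ne_bot hK
  have hinner : ⟪e, b₀⟫ = 0 := (Submodule.mem_orthogonal_singleton_iff_inner_right).1 hb₀K
  refine ⟨‖b₀‖⁻¹ • b₀, ?_, ?_⟩
  · rw [norm_smul, norm_inv, norm_norm, inv_mul_cancel₀ (norm_ne_zero_iff.2 hb₀)]
  · rw [real_inner_smul_right, hinner, mul_zero]

/-- **(H1) Hadamard-type bound through one direction.** For a linear map `J` of `ℝ³` and a unit vector `e`: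
`|det J| ≤ ‖J e‖ · ‖J‖²`.  Proof: pick a unit `b ⊥ e`, `c := e × b` (unit, and `⟪e, b × c⟫ = ‖e × b‖² = 1`); then
`det J = ⟪J e, J b × J c⟫` and Cauchy–Schwarz + Lagrange give `|det J| ≤ ‖J e‖ ‖J b‖ ‖J c‖ ≤ ‖J e‖ ‖J‖²`.
[folklore] -/
theorem abs_det_le_norm_apply_mul_opNorm_sq
    (J : EuclideanSpace ℝ (Fin 3) →L[ℝ] EuclideanSpace ℝ (Fin 3)) (e : EuclideanSpace ℝ (Fin 3))
    (he : ‖e‖ = 1) :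
    |LinearMap.det (J : EuclideanSpace ℝ (Fin 3) →ₗ[ℝ] EuclideanSpace ℝ (Fin 3))| ≤ ‖J e‖ * ‖J‖ ^ 2 := by
  -- coordinates of `⟪·,·⟫` and `×` on `ℝ³`; Lagrange's identity; cyclic symmetry of the triple product
  have hi : ∀ x y : EuclideanSpace ℝ (Fin 3), ⟪x, y⟫ = x 0 * y 0 + x 1 * y 1 + x 2 * y 2 := fun x y => by
    simp [PiLp.inner_apply, Fin.sum_univ_three, mul_comm]
  have hc0 : ∀ v w : EuclideanSpace ℝ (Fin 3), cross v w 0 = v 1 * w 2 - v 2 * w 1 := fun v w => by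
    simp [cross, cross_apply]
  have hc1' : ∀ v w : EuclideanSpace ℝ (Fin 3), cross v w 1 = v 2 * w 0 - v 0 * w 2 := fun v w => by
    simp [cross, cross_apply]
  have hc2 : ∀ v w : EuclideanSpace ℝ (Fin 3), cross v w 2 = v 0 * w 1 - v 1 * w 0 := fun v w => by
    simp [cross, cross_apply]
  have hLag : ∀ v w : EuclideanSpace ℝ (Fin 3), ‖cross v w‖ ^ 2 = ‖v‖ ^ 2 * ‖w‖ ^ 2 - ⟪v, w⟫ ^ 2 := by
    intro v w
    rw [← real_inner_self_eq_norm_sq, ← real_inner_self_eq_norm_sq, ← real_inner_self_eq_norm_sq, hi, hi, hi, hi,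
      hc0, hc1', hc2]
    ring
  have hcle : ∀ v w : EuclideanSpace ℝ (Fin 3), ‖cross v w‖ ≤ ‖v‖ * ‖w‖ := by
    intro v w
    have h := hLag v w
    have h0 : 0 ≤ ‖v‖ * ‖w‖ := by positivity
    nlinarith [sq_nonneg ⟪v, w⟫, norm_nonneg (cross v w)]
  have hcyc : ∀ a b c : EuclideanSpace ℝ (Fin 3), ⟪a, cross b c⟫ = ⟪c, cross a b⟫ := by
    intro a b c
    rw [hi, hi, hc0, hc1', hc2, hc0, hc1', hc2]
    ring
  obtain ⟨b, hb, heb⟩ := exists_norm_eq_one_inner_eq_zero e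
  set c := cross e b with hc
  -- `‖c‖ = 1` and `⟪e, b × c⟫ = 1`
  have hc1 : ‖c‖ ^ 2 = 1 := by rw [hc, hLag, he, hb, heb]; norm_num
  have hcn : ‖c‖ = 1 := by
    have := norm_nonneg c
    nlinarith
  have htriple : ⟪e, cross b c⟫ = 1 := by
    rw [hcyc, hc, real_inner_self_eq_norm_sq, ← hc, hc1]
  -- the determinant as a triple product
  have hdet : LinearMap.det (J : EuclideanSpace ℝ (Fin 3) →ₗ[ℝ] EuclideanSpace ℝ (Fin 3)) =
      ⟪J e, cross (J b) (J c)⟫ := by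
    have h := det_mul_inner_cross (J : EuclideanSpace ℝ (Fin 3) →ₗ[ℝ] EuclideanSpace ℝ (Fin 3)) e b c
    rw [htriple, mul_one] at h
    simpa using h
  rw [hdet]
  calc |⟪J e, cross (J b) (J c)⟫| ≤ ‖J e‖ * ‖cross (J b) (J c)‖ := abs_real_inner_le_norm _ _
    _ ≤ ‖J e‖ * (‖J b‖ * ‖J c‖) := by gcongr; exact hcle _ _
    _ ≤ ‖J e‖ * (‖J‖ * ‖b‖ * (‖J‖ * ‖c‖)) := by
        gcongr
        · exact J.le_opNorm b
        · exact J.le_opNorm c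
    _ = ‖J e‖ * ‖J‖ ^ 2 := by rw [hb, hcn]; ring

/-- (H1) in the `ContinuousLinearMap.det` spelling used by the flow files. [folklore] -/
theorem abs_det_le_norm_apply_mul_opNorm_sq'
    (J : EuclideanSpace ℝ (Fin 3) →L[ℝ] EuclideanSpace ℝ (Fin 3)) (e : EuclideanSpace ℝ (Fin 3))
    (he : ‖e‖ = 1) : |J.det| ≤ ‖J e‖ * ‖J‖ ^ 2 :=
  abs_det_le_norm_apply_mul_opNorm_sq J e he

/-! ## (H2) Residence is uniformly hyperbolic -/

variable {γ : ℝ} {U V : EuclideanSpace ℝ (Fin 3) → EuclideanSpace ℝ (Fin 3)} {P : EuclideanSpace ℝ (Fin 3) → ℝ}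

/-- **RESIDENCE IS UNIFORMLY HYPERBOLIC (t40c).**  `(U, P)` a self-similar Euler profile, `V ∈ C²` a cut-off copy
(`‖DV‖ ≤ K`, `V = U` on `ball 0 R_big`), `M < R_big`, `‖curl U‖ ≤ O` on `B̄_M`; if the backward orbit of `y` lingers in
`B̄_M` during `[0, L]` then for every `σ ∈ [0, L]`:
`‖curl U y‖ · e^{(1−2γ)σ} ≤ O · ‖DΨ_σ(y)‖²`.
Proof: trivial if `curl U y = 0`; otherwise (H1) with `e = Ω̂(y)` gives
`e^{−3γσ} = det DΨ_σ(y) ≤ ‖DΨ_σ(y) Ω(y)‖/‖Ω(y)‖ · ‖DΨ_σ(y)‖²` (t40b) and `‖DΨ_σ(y) Ω(y)‖ ≤ e^{−(1+γ)σ} O` (t40a).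
[cite: ConstantinIgnatovaVicol2026Putative, §3.4.1 eq. (3.22)–(3.24)] -/
theorem norm_fderiv_flow_sq_ge_linger (hprof : IsSelfSimilarEulerProfile γ 0 U P) (hV : ContDiff ℝ 2 V) {K : ℝ}
    (hK : ∀ y, ‖fderiv ℝ V y‖ ≤ K) {M Rbig : ℝ} (hMR : M < Rbig)
    (hVU : ∀ w ∈ ball (0 : EuclideanSpace ℝ (Fin 3)) Rbig, V w = U w) {O : ℝ}
    (hO : ∀ z ∈ closedBall (0 : EuclideanSpace ℝ (Fin 3)) M, ‖curl U z‖ ≤ O) {y : EuclideanSpace ℝ (Fin 3)} {L : ℝ}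
    (hy : ∀ σ ∈ Icc (0 : ℝ) L, ‖ODE.evolutionMap (fun _ : ℝ => selfSimilarTransport γ 0 V) 0 (-σ) y‖ ≤ M) :
    ∀ σ ∈ Icc (0 : ℝ) L,
      ‖curl U y‖ * Real.exp ((1 - 2 * γ) * σ) ≤
        O * ‖fderiv ℝ (ODE.evolutionMap (fun _ : ℝ => selfSimilarTransport γ 0 V) 0 (-σ)) y‖ ^ 2 := by
  intro σ hσ
  set J := fderiv ℝ (ODE.evolutionMap (fun _ : ℝ => selfSimilarTransport γ 0 V) 0 (-σ)) y with hJ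
  have hO0 : 0 ≤ O := (norm_nonneg _).trans (hO _ (mem_closedBall_zero_iff.2 (hy σ hσ)))
  by_cases hΩ : curl U y = 0
  · rw [hΩ, norm_zero, zero_mul]; positivity
  have hΩn : 0 < ‖curl U y‖ := norm_pos_iff.2 hΩ
  -- the unit vorticity direction
  set e : EuclideanSpace ℝ (Fin 3) := ‖curl U y‖⁻¹ • curl U y with he
  have he1 : ‖e‖ = 1 := by
    rw [he, norm_smul, norm_inv, norm_norm, inv_mul_cancel₀ hΩn.ne']
  -- (H1) + Liouville (t40b) + vortex-line crushing (t40a)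
  have hdet : J.det = Real.exp (-(3 * γ) * σ) := det_fderiv_flow_neg_linger hprof hV hK hMR hVU hy σ hσ
  have hcurl : ‖J (curl U y)‖ ≤ Real.exp (-((1 + γ) * σ)) * O :=
    norm_fderiv_flow_curl_le_linger hprof hV hK hMR hVU hO hy hσ
  have hJe : ‖J e‖ = ‖curl U y‖⁻¹ * ‖J (curl U y)‖ := by
    rw [he, map_smul, norm_smul, norm_inv, norm_norm]
  have h1 : Real.exp (-(3 * γ) * σ) ≤ ‖curl U y‖⁻¹ * (Real.exp (-((1 + γ) * σ)) * O) * ‖J‖ ^ 2 := by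
    calc Real.exp (-(3 * γ) * σ) = |J.det| := by rw [hdet, abs_of_pos (Real.exp_pos _)]
      _ ≤ ‖J e‖ * ‖J‖ ^ 2 := abs_det_le_norm_apply_mul_opNorm_sq' J e he1
      _ = ‖curl U y‖⁻¹ * ‖J (curl U y)‖ * ‖J‖ ^ 2 := by rw [hJe]
      _ ≤ ‖curl U y‖⁻¹ * (Real.exp (-((1 + γ) * σ)) * O) * ‖J‖ ^ 2 := by gcongr
  -- bookkeeping: multiply by `‖Ω(y)‖ e^{(1+γ)σ}`
  have hexp : Real.exp ((1 - 2 * γ) * σ) = Real.exp ((1 + γ) * σ) * Real.exp (-(3 * γ) * σ) := by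
    rw [← Real.exp_add]; ring_nf
  have hee : Real.exp ((1 + γ) * σ) * Real.exp (-((1 + γ) * σ)) = 1 := by
    rw [← Real.exp_add, add_neg_cancel, Real.exp_zero]
  have hpos : 0 ≤ ‖curl U y‖ * Real.exp ((1 + γ) * σ) := by positivity
  calc ‖curl U y‖ * Real.exp ((1 - 2 * γ) * σ)
      = (‖curl U y‖ * Real.exp ((1 + γ) * σ)) * Real.exp (-(3 * γ) * σ) := by rw [hexp]; ring
    _ ≤ (‖curl U y‖ * Real.exp ((1 + γ) * σ)) *
          (‖curl U y‖⁻¹ * (Real.exp (-((1 + γ) * σ)) * O) * ‖J‖ ^ 2) := mul_le_mul_of_nonneg_left h1 hpos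
    _ = (‖curl U y‖ * ‖curl U y‖⁻¹) * (Real.exp ((1 + γ) * σ) * Real.exp (-((1 + γ) * σ))) * O * ‖J‖ ^ 2 := by
          ring
    _ = O * ‖J‖ ^ 2 := by rw [mul_inv_cancel₀ hΩn.ne', hee]; ring

/-- **RESIDENCE IS UNIFORMLY HYPERBOLIC, packaged**: `∃ O ≥ 0` (`= sup_{B̄_M}‖curl U‖ ⊔ 0`) such that for every `C²`
cut-off copy, every lingering label and every `σ ∈ [0, L]`: `‖curl U y‖ · e^{(1−2γ)σ} ≤ O · ‖DΨ_σ(y)‖²`. [folklore] -/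
theorem norm_fderiv_flow_sq_ge_linger' (hprof : IsSelfSimilarEulerProfile γ 0 U P) (M : ℝ) :
    ∃ O : ℝ, 0 ≤ O ∧ ∀ (V : EuclideanSpace ℝ (Fin 3) → EuclideanSpace ℝ (Fin 3)) (K Rbig : ℝ),
      ContDiff ℝ 2 V → (∀ y, ‖fderiv ℝ V y‖ ≤ K) → M < Rbig →
      (∀ w ∈ ball (0 : EuclideanSpace ℝ (Fin 3)) Rbig, V w = U w) →
      ∀ (y : EuclideanSpace ℝ (Fin 3)) (L : ℝ),
      (∀ σ ∈ Icc (0 : ℝ) L, ‖ODE.evolutionMap (fun _ : ℝ => selfSimilarTransport γ 0 V) 0 (-σ) y‖ ≤ M) →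
      ∀ σ ∈ Icc (0 : ℝ) L,
        ‖curl U y‖ * Real.exp ((1 - 2 * γ) * σ) ≤
          O * ‖fderiv ℝ (ODE.evolutionMap (fun _ : ℝ => selfSimilarTransport γ 0 V) 0 (-σ)) y‖ ^ 2 := by
  have hU2 : ContDiff ℝ 2 U := hprof.isSelfSimilarEulerVorticityProfile.contDiff_velocity
  obtain ⟨B, hB⟩ := (isCompact_closedBall (0 : EuclideanSpace ℝ (Fin 3)) M).exists_bound_of_continuousOn
    (differentiable_curl_of_contDiff hU2).continuous.continuousOn
  refine ⟨max B 0, le_max_right _ _, ?_⟩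
  intro V K Rbig hV hK hMR hVU y L hy σ hσ
  exact norm_fderiv_flow_sq_ge_linger hprof hV hK hMR hVU (fun z hz => (hB z hz).trans (le_max_left _ _)) hy σ hσ

/-- **The stretched direction, square-root form**: along a lingering vortical orbit,
`√(‖curl U y‖ · e^{(1−2γ)σ} / O) ≤ ‖DΨ_σ(y)‖` (`O > 0`). [folklore] -/
theorem sqrt_le_norm_fderiv_flow_linger (hprof : IsSelfSimilarEulerProfile γ 0 U P) (hV : ContDiff ℝ 2 V) {K : ℝ}
    (hK : ∀ y, ‖fderiv ℝ V y‖ ≤ K) {M Rbig : ℝ} (hMR : M < Rbig)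
    (hVU : ∀ w ∈ ball (0 : EuclideanSpace ℝ (Fin 3)) Rbig, V w = U w) {O : ℝ} (hOpos : 0 < O)
    (hO : ∀ z ∈ closedBall (0 : EuclideanSpace ℝ (Fin 3)) M, ‖curl U z‖ ≤ O) {y : EuclideanSpace ℝ (Fin 3)} {L : ℝ}
    (hy : ∀ σ ∈ Icc (0 : ℝ) L, ‖ODE.evolutionMap (fun _ : ℝ => selfSimilarTransport γ 0 V) 0 (-σ) y‖ ≤ M)
    {σ : ℝ} (hσ : σ ∈ Icc (0 : ℝ) L) :
    Real.sqrt (‖curl U y‖ * Real.exp ((1 - 2 * γ) * σ) / O) ≤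
      ‖fderiv ℝ (ODE.evolutionMap (fun _ : ℝ => selfSimilarTransport γ 0 V) 0 (-σ)) y‖ := by
  have h := norm_fderiv_flow_sq_ge_linger hprof hV hK hMR hVU hO hy σ hσ
  rw [Real.sqrt_le_left (norm_nonneg _), div_le_iff₀ hOpos]
  linarith [h]

end Summit.NavierStokesRegularity.NavierStokesRegularity.Theorems.PowerGaugeEulerLiouville.NeedleClock

end
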